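import Mathlib

/-!
# THE GAUSSIAN FIELD `ℚ(ζ₄) = ℚ(i)` AND THE PRIME `2`: the elementary inputs of a concrete ramified place
(T5GaussianField)

The ingredients of a CONCRETE instance of the ramified quadratic chain (rows 169–177): the field
`L := ℚ(ζ₄)` (Mathlib's `CyclotomicField 4 ℚ`) with its primitive fourth root of unity `ζ` (`ζ² = −1`,
`(1 + ζ)² = 2ζ`, `ζ` integral, `[L : ℚ] = 2`), the place `v₂` of `ℚ` at `2` as a `HeightOneSpectrum (𝓞 ℚ)`
(`v₂.asIdeal = (2)`, `primesEquiv v₂ = 2`), and the 2-adic fact that `−1` is NOT a square in `ℚ₂`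
(reduce a square root of `−1` in `ℤ₂` to `ℤ/4`) transported to `ℚ_{v₂}` through Mathlib's
`adicCompletion.padicEquiv`. Everything here is Mathlib arithmetic; the concrete place is assembled in
T5GaussianPlace.

No axiom beyond the standard trio; nothing of the scored record changes.
§8(d): uses an L-value-free non-vanishing device: NO.
-/

namespace Summit.Ventures.HodgeRepro2.T5GaussianField

open IsDedekindDomain HeightOneSpectrum NumberField

/-! ### The field `ℚ(ζ₄)` -/

/-- `L := ℚ(ζ₄)`, Mathlib's `CyclotomicField 4 ℚ`. -/
abbrev L : Type := CyclotomicField 4 ℚ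

/-- `L` is the cyclotomic extension of `ℚ` of order `4` (Mathlib's instance, stated for the `ℚ`-algebra structure
`DivisionRing.toRatAlgebra` that every other statement about `L` uses; `IsCyclotomicExtension` is a `Prop`). -/
theorem isCyclotomic : IsCyclotomicExtension {4} ℚ L := CyclotomicField.isCyclotomicExtension 4 ℚ

/-- The primitive fourth root of unity `ζ` of `L`. -/
noncomputable def ζ : L :=
  haveI := isCyclotomic
  IsCyclotomicExtension.zeta 4 ℚ L

/-- `ζ` is a primitive fourth root of unity. -/
theorem isPrimitiveRoot_zeta : IsPrimitiveRoot ζ 4 :=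
  haveI := isCyclotomic
  IsCyclotomicExtension.zeta_spec 4 ℚ L

/-- `ζ⁴ = 1`. -/
theorem zeta_pow_four : ζ ^ 4 = 1 := isPrimitiveRoot_zeta.pow_eq_one

/-- `ζ² = −1`. -/
theorem zeta_sq : ζ ^ 2 = -1 := by
  have h4 : (ζ ^ 2) * (ζ ^ 2) = 1 := by rw [← pow_add, zeta_pow_four]
  have h2 : ζ ^ 2 ≠ 1 := isPrimitiveRoot_zeta.pow_ne_one_of_pos_of_lt (by norm_num) (by norm_num)
  rcases mul_self_eq_one_iff.mp h4 with h | h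
  · exact absurd h h2
  · exact h

/-- `ζ ≠ 0`. -/
theorem zeta_ne_zero : ζ ≠ 0 := by
  intro h
  have := zeta_sq
  rw [h] at this
  norm_num at this

/-- `ζ` is a unit: `ζ · ζ³ = 1`. -/
theorem zeta_mul_zeta_pow_three : ζ * ζ ^ 3 = 1 := by
  rw [← pow_succ', zeta_pow_four]

/-- `(1 + ζ)² = 2 ζ`. -/
theorem one_add_zeta_sq : (1 + ζ) ^ 2 = 2 * ζ := by
  have := zeta_sq
  linear_combination this

/-- `[ℚ(ζ₄) : ℚ] = 2`. -/
theorem finrank_eq_two : Module.finrank ℚ L = 2 := by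
  haveI := isCyclotomic
  rw [IsCyclotomicExtension.finrank L (Polynomial.cyclotomic.irreducible_rat (by norm_num : 0 < 4))]
  decide

/-- `ζ` is integral over `ℤ`. -/
theorem zeta_isIntegral : IsIntegral ℤ ζ := isPrimitiveRoot_zeta.isIntegral (by norm_num)

/-- `ζ` as an element of `𝓞 L`. -/
noncomputable def ζO : NumberField.RingOfIntegers L := ⟨ζ, zeta_isIntegral⟩

/-- `ζO` is `ζ`. -/
@[simp] theorem coe_zetaO : (ζO : L) = ζ := rfl

/-- `(1 + ζ)² = 2 ζ` in `𝓞 L`. -/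
theorem one_add_zetaO_sq : (1 + ζO) ^ 2 = 2 * ζO := by
  apply NumberField.RingOfIntegers.ext
  push_cast
  exact one_add_zeta_sq

/-- `ζ · ζ³ = 1` in `𝓞 L`. -/
theorem zetaO_mul_zetaO_pow_three : ζO * ζO ^ 3 = 1 := by
  apply NumberField.RingOfIntegers.ext
  push_cast
  exact zeta_mul_zeta_pow_three

/-! ### The prime `2` of `ℚ` -/

/-- The finite place `v₂` of `ℚ` at the prime `2`, as a height-one prime of `𝓞 ℚ` (through Mathlib's
`Rat.HeightOneSpectrum.primesEquiv`). -/
noncomputable def v₂ : HeightOneSpectrum (NumberField.RingOfIntegers ℚ) :=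
  (Rat.HeightOneSpectrum.primesEquiv (R := NumberField.RingOfIntegers ℚ)).symm ⟨2, Nat.prime_two⟩

/-- `primesEquiv v₂ = 2`. -/
theorem primesEquiv_v₂ :
    Rat.HeightOneSpectrum.primesEquiv (R := NumberField.RingOfIntegers ℚ) v₂ = ⟨2, Nat.prime_two⟩ :=
  Equiv.apply_symm_apply _ _

/-- `(primesEquiv v₂ : ℕ) = 2`. -/
theorem primesEquiv_v₂_val :
    ((Rat.HeightOneSpectrum.primesEquiv (R := NumberField.RingOfIntegers ℚ) v₂ : Nat.Primes) : ℕ) = 2 := by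
  rw [primesEquiv_v₂]

/-! ### `−1` is not a square in `ℚ₂` -/

/-- `−1` is not a square in `ℚ_p` for `p = 2`: a square root would be a 2-adic integer, and `−1 = 3` is not a
square in `ℤ/4`. -/
theorem not_exists_sq_eq_neg_one_padic (p : ℕ) [hp : Fact p.Prime] (h2 : p = 2) :
    ¬ ∃ y : ℚ_[p], y ^ 2 = -1 := by
  subst h2
  rintro ⟨y, hy⟩
  have hnorm : ‖y‖ ≤ 1 := by
    have h1 : ‖y‖ ^ 2 = 1 := by rw [← norm_pow, hy, norm_neg, norm_one]
    nlinarith [norm_nonneg y]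
  set z : ℤ_[2] := ⟨y, hnorm⟩ with hz
  have hz2 : z ^ 2 = -1 := by
    apply Subtype.ext
    simp [hz, hy]
  have hmod := congrArg (PadicInt.toZModPow 2) hz2
  rw [map_pow, map_neg, map_one] at hmod
  have key : ∀ a : ZMod (2 ^ 2), a ^ 2 ≠ -1 := by decide
  exact key _ hmod

/-- `−1` is not a square in `ℚ_{v₂}` (transport through `adicCompletion.padicEquiv`). -/
theorem not_exists_sq_eq_neg_one : ¬ ∃ y : v₂.adicCompletion ℚ, y ^ 2 = -1 := by
  rintro ⟨y, hy⟩
  haveI : Fact (Nat.Prime ((Rat.HeightOneSpectrum.primesEquiv (R := NumberField.RingOfIntegers ℚ) v₂ :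
      Nat.Primes) : ℕ)) := ⟨(Rat.HeightOneSpectrum.primesEquiv v₂).2⟩
  apply not_exists_sq_eq_neg_one_padic _ primesEquiv_v₂_val
  refine ⟨Rat.HeightOneSpectrum.adicCompletion.padicEquiv v₂ y, ?_⟩
  rw [← map_pow, hy, map_neg, map_one]

end Summit.Ventures.HodgeRepro2.T5GaussianField
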